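import Mathlib.Data.Real.Basic
import Mathlib.Tactic.LinearCombination
import Mathlib.Tactic.Linarith
import Mathlib.Tactic.Positivity
import Summits.CriticalPhenomena.PercolationContinuityZ3.Theorems.PercNearOneGluingNoHeavyQuantLSCoreMMGIneqA
import Mathlib.Tactic.FieldSimp
import Mathlib.Tactic.Ring
import HarnessLib

/-!
# QUANT lane R8, T-DEC, binder (II) `ConvClosedTResidue`: LS-CORE, pattern LMG — polynomial certificates of the breakpoint inequalities (part L: auxiliary cell QNP2 (low 1 fits into the giant pool when (p+l′,m+l′) and (p+l′,p+h) are heavy and m+l is low))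

builds on p205010 (kernel theorem, internal audit signed; external expert review pending)

Support file (`--supports stmt-CriticalPhenomena-4575`), QUANT lane seat prim-quant-census-1 (gen 22), rung R8 of
`run/shared/lean/prim/quant/LADDER.md`.  Theorems only (real polynomial inequalities), standard axioms, no sorries.  Memo
`run/shared/lean/prim/quant/prim-quant-census-1/LSCORE-G22.md` (derivation of the forms), code `code/s5_final.py` (forms), `code/cert5.py`
(certificates: Handelman products of the region generators, LP by HiGHS, exact rational repair) in the seat folder of census-1 g22.

COORDINATES (memo §2).  The light slice `(1−γ)·shift_p ν_B + γ·shift_m ν_B` of the Type-I atom `ν_B` (lows `l < l′`, absorber `h`, light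
rate `ρ_ℓ < x`, expensive rate `ρ_e > x`) by the light credit pair `{p, m; γ}` (`γ = x² + (1−x)ρ_c`) is scale free in the unit `e = h − l′`:
`x` the floor, `r = ρ_ℓ`, `t = (l′ − l)/e`, `w = (m − p)/e ≤ 1` (the span ratio ω) and `d = ρ_c·w` (so `A = r + d` and `B = A + 2t` are the
deficits `(T − 2(p+l′))/e`, `(T − 2(p+l))/e` of the two lows, `D = t(2 − x² − (1−x)r) − x(x−r) > 0` the denominator of the tail weights
`λ = (x−r)(1−t−r)/D`, `λ′ = (1+x−r)(r−x+t(2−x))/D`).  Each lemma is ONE breakpoint inequality of the two-low greedy (`…QuantTwoLowGreedy`)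
on ONE light/heavy/absent branch of the six cross pairs, cleared of its (positive) denominators: `0 ≤ N` on the cell cut out by the listed
sign conditions, with an explicit certificate `N = Σ cᵢ·(product of conditions)`, `cᵢ ≥ 0`, replayed by `linear_combination`.

[this work].  Nothing here is cited as a published result.  The gluing rows served [cite: KozmaNitzan2024, Conjecture 3 (p. 15)];
product measure [cite: Grimmett1999, §1.3 p. 10].
-/

namespace Summit.CriticalPhenomena.PercolationContinuityZ3.Theorems

namespace Quant

namespace LawDec

namespace LSCoreLMG

set_option maxHeartbeats 8000000 in
set_option maxRecDepth 20000 in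
/-- **cell `LMG_QNP2_22H_2PH`** (breakpoint inequality; branch `22H_2PH`: pre-routing case and light/heavy/absent letters of the cross pairs): the cleared obligation is an exact
nonnegative combination of 26 products of the region's sign conditions (LP certificate found with HiGHS, exact rational repair,
identity re-verified by an independent polynomial engine). [this work] -/
theorem lcell_QNP2_22H_2PH (x r t d w : ℝ) (h0 : 0 ≤ x) (h1 : 0 ≤ -x + 1) (h2 : 0 ≤ r) (h3 : 0 ≤ -r + x) (h4 : 0 ≤ t) (h5 : 0 ≤ w) (h6 : 0 ≤ -w + 1) (h7 : 0 ≤ d) (h8 : 0 ≤ x * w - d) (h9 : 0 ≤ -x * t + 2 * t + r - x) (h10 : 0 ≤ -t - r + 1) (h11 : 0 ≤ x * r * t - x ^ 2 * t - r * t + x * r - x ^ 2 + 2 * t) (h12 : 0 ≤ d + r - x) (h13 : 0 ≤ w - d - r) (h14 : 0 ≤ -2 * w + d + 2 * t + r) (h16 : 0 ≤ -d - t - r + 1) :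
    0 ≤ x ^ 3 * r * t * w - x ^ 4 * t * w - x ^ 2 * r * t * d + x ^ 2 * r ^ 2 * w - x ^ 3 * t * w + x ^ 3 * t * d - x ^ 4 * w + x * r * t * d - x * r ^ 2 * d + 2 * x ^ 2 * t * w - x ^ 2 * r * w + x ^ 3 * w + x ^ 3 * d - r * t * w - r ^ 2 * w + r ^ 2 * d + x * t * w - 3 * x * t * d + x * r * w + x * r * d - 2 * x ^ 2 * d + 2 * t * d + r * w - r * d - x * w + x * d := by
  linear_combination (1 / 2 : ℝ) * (mul_nonneg h3 h12)
    + (1 / 3 : ℝ) * (mul_nonneg h3 h13)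
    + (1 / 6 : ℝ) * (mul_nonneg h3 h14)
    + (1 : ℝ) * (mul_nonneg h11 h12)
    + (1 / 2 : ℝ) * (mul_nonneg (mul_nonneg h0 h3) h9)
    + (1 : ℝ) * (mul_nonneg (mul_nonneg h0 h8) h11)
    + (1 / 6 : ℝ) * (mul_nonneg (mul_nonneg h1 h3) h12)
    + (2 / 3 : ℝ) * (mul_nonneg (mul_nonneg h1 h3) h13)
    + (5 / 6 : ℝ) * (mul_nonneg (mul_nonneg h1 h3) h14)
    + (1 / 6 : ℝ) * (mul_nonneg (mul_nonneg h2 h3) h8)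
    + (1 / 6 : ℝ) * (mul_nonneg (mul_nonneg h3 h4) h13)
    + (1 / 3 : ℝ) * (mul_nonneg (mul_nonneg h3 h5) h9)
    + (1 / 4 : ℝ) * (mul_nonneg (mul_nonneg h3 h8) h9)
    + (1 / 6 : ℝ) * (mul_nonneg (mul_nonneg (mul_nonneg h0 h0) h3) h16)
    + (1 / 6 : ℝ) * (mul_nonneg (mul_nonneg (mul_nonneg h0 h2) h3) h4)
    + (5 / 12 : ℝ) * (mul_nonneg (mul_nonneg (mul_nonneg h0 h3) h8) h10)
    + (1 / 6 : ℝ) * (mul_nonneg (mul_nonneg (mul_nonneg h1 h1) h3) h7)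
    + (5 / 12 : ℝ) * (mul_nonneg (mul_nonneg (mul_nonneg h1 h2) h3) h8)
    + (2 / 3 : ℝ) * (mul_nonneg (mul_nonneg (mul_nonneg h1 h3) h3) h4)
    + (1 / 2 : ℝ) * (mul_nonneg (mul_nonneg (mul_nonneg h1 h3) h3) h6)
    + (1 / 6 : ℝ) * (mul_nonneg (mul_nonneg (mul_nonneg h1 h3) h4) h13)
    + (1 / 6 : ℝ) * (mul_nonneg (mul_nonneg (mul_nonneg h1 h3) h7) h10)
    + (1 / 6 : ℝ) * (mul_nonneg (mul_nonneg (mul_nonneg (mul_nonneg h0 h0) h2) h3) h6)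
    + (1 / 6 : ℝ) * (mul_nonneg (mul_nonneg (mul_nonneg (mul_nonneg h0 h0) h3) h6) h9)
    + (1 / 6 : ℝ) * (mul_nonneg (mul_nonneg (mul_nonneg (mul_nonneg h1 h1) h3) h3) h6)
    + (1 / 6 : ℝ) * (mul_nonneg (mul_nonneg (mul_nonneg (mul_nonneg (mul_nonneg h0 h0) h0) h3) h4) h6)

set_option maxHeartbeats 4000000 in
/-- **`P₁ ≤ pool` when the pairs `(p+l′, m+l′)` and `(p+l′, p+h)` are heavy and `m+l` is a low with `p+l` available**
(`x·w ≤ A < w`, `x ≤ A`, `2w < B < 1+t`): the far low `p+l` fits into the giant pool by itself, so the head-cell breakpoint `kB` is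
immediate on this branch of pattern LMG (no certificate for the breakpoint itself is needed).  From `lcell_QNP2_22H_2PH` by dividing
by `w·D > 0`. [this work] -/
theorem P1_le_pool_22H_2PH (x r t d w : ℝ) (hx0 : 0 < x) (hx1 : x < 1) (hr0 : 0 ≤ r) (hrx : r < x) (ht : 0 < t)
    (hw0 : 0 < w) (hd0 : 0 ≤ d) (hdx : d < x * w) (hre : 0 < r - x + t * (2 - x))
    (hM1 : 2 * w < r + d + 2 * t) (h2H : x ≤ r + d) (h22b : r + d < w) (h1P : r + d + 2 * t < 1 + t) :
    ((1 - (x ^ 2 + (1 - x) * d / w)) * (1 - x) * ((x - r) * (1 - t - r) / (t * (2 - x ^ 2 - (1 - x) * r) - x * (x - r)))) ≤ ((x ^ 2 + (1 - x) * d / w) * (1 - x)) := by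
  have hD : 0 < (t * (2 - x ^ 2 - (1 - x) * r) - x * (x - r)) := LSCoreMMG.D_pos x r t hx0 hx1 hr0 hrx hre
  have hN := lcell_QNP2_22H_2PH x r t d w hx0.le (by linarith) hr0 (by linarith) ht.le hw0.le (by linarith) hd0 (by linarith)
    (by nlinarith) (by linarith) (by nlinarith [hD]) (by linarith) (by linarith) (by linarith) (by linarith)
  have hDne : (t * (2 - x ^ 2 - (1 - x) * r) - x * (x - r)) ≠ 0 := hD.ne'
  have hwne : w ≠ 0 := hw0.ne'
  have key : ((x ^ 2 + (1 - x) * d / w) * (1 - x)) - ((1 - (x ^ 2 + (1 - x) * d / w)) * (1 - x) * ((x - r) * (1 - t - r) / (t * (2 - x ^ 2 - (1 - x) * r) - x * (x - r))))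
      = (1 - x) * (x ^ 3 * r * t * w - x ^ 4 * t * w - x ^ 2 * r * t * d + x ^ 2 * r ^ 2 * w - x ^ 3 * t * w + x ^ 3 * t * d - x ^ 4 * w + x * r * t * d - x * r ^ 2 * d + 2 * x ^ 2 * t * w - x ^ 2 * r * w + x ^ 3 * w + x ^ 3 * d - r * t * w - r ^ 2 * w + r ^ 2 * d + x * t * w - 3 * x * t * d + x * r * w + x * r * d - 2 * x ^ 2 * d + 2 * t * d + r * w - r * d - x * w + x * d) / (w * (t * (2 - x ^ 2 - (1 - x) * r) - x * (x - r))) := by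
    field_simp
    ring
  have h2 : 0 ≤ (1 - x) * (x ^ 3 * r * t * w - x ^ 4 * t * w - x ^ 2 * r * t * d + x ^ 2 * r ^ 2 * w - x ^ 3 * t * w + x ^ 3 * t * d - x ^ 4 * w + x * r * t * d - x * r ^ 2 * d + 2 * x ^ 2 * t * w - x ^ 2 * r * w + x ^ 3 * w + x ^ 3 * d - r * t * w - r ^ 2 * w + r ^ 2 * d + x * t * w - 3 * x * t * d + x * r * w + x * r * d - 2 * x ^ 2 * d + 2 * t * d + r * w - r * d - x * w + x * d) / (w * (t * (2 - x ^ 2 - (1 - x) * r) - x * (x - r))) :=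
    div_nonneg (mul_nonneg (by linarith) hN) (mul_pos hw0 hD).le
  linarith [key, h2]

end LSCoreLMG

end LawDec

end Quant

end Summit.CriticalPhenomena.PercolationContinuityZ3.Theorems
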